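import Summits.QuantumFields.QCD.Theses.HeatSlicedQuarks
import Literature.Analysis.InnerProduct.GramHadamard
import Literature.LinearAlgebra.Matrix.GramDeterminantKernel

/-!
# Crux `InterleavedFlowProper` (stmt-QuantumFields-18031), line `finite-range-heat-slices` —
# stub `stub_psdGramHadamard` (FORMAT 2): Gram–Hadamard for positive-semidefinite-sliced pairings

Registered helper `stub_psdGramHadamardDet` = the body of `PSDGramHadamard` of the skeleton
`Cruxes/InterleavedFlowProper/Lines/finite_range_heat_slices.lean` (namespace
`Summit.QuantumFields.QCD.Cruxes.InterleavedFlowProper.FiniteRangeHeatSlices`); the skeleton's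
`stub_psdGramHadamard : PSDGramHadamard` is this theorem by `Iff.rfl`/definitional unfolding.

Statement: for a positive semi-definite `Φ` and ANY matrix `D` on a finite index set, every `n × n` minor of the
pairing kernel `Φ Dᴴ` taken at rows `x₁ … xₙ` and columns `y₁ … yₙ` obeys
`|det[(Φ Dᴴ)(xᵢ, yⱼ)]| ≤ ∏ᵢ √(Φ(xᵢ,xᵢ)) · ∏ⱼ √((D Φ Dᴴ)(yⱼ,yⱼ))`.
Proof: Gram factorisation `(ΦDᴴ)(x,y) = ⟨Φ^{1/2}δ_x, Φ^{1/2}Dᴴδ_y⟩`, Cauchy–Binet / Cauchy–Schwarz for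
`det(AᴴB)`, Hadamard's inequality. [Gram–Hadamard; GK doi:10.1007/bf01208817, FMRS doi:10.1007/bf01464282]
-/

namespace Summit.QuantumFields.QCD.Cruxes.InterleavedFlowProper.FiniteRangeHeatSlices

open scoped BigOperators Matrix ComplexOrder InnerProductSpace

/-- Inner products of matrix columns in `EuclideanSpace ℂ ι`: `⟪A_{·k}, B_{·l}⟫ = (Aᴴ B)_{k l}`.
[folklore] -/
theorem inner_toLp_col_toLp_col {ι : Type} [Fintype ι] (A B : Matrix ι ι ℂ) (k l : ι) :
    ⟪(WithLp.toLp 2 fun w => A w k : EuclideanSpace ℂ ι), WithLp.toLp 2 fun w => B w l⟫_ℂ =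
      (Aᴴ * B) k l := by
  rw [EuclideanSpace.inner_toLp_toLp, Matrix.mul_apply, dotProduct]
  refine Finset.sum_congr rfl fun w _ => ?_
  rw [Matrix.conjTranspose_apply, Pi.star_apply, mul_comm]

/-- Norms of matrix columns in `EuclideanSpace ℂ ι`: `‖A_{·k}‖ = √(re (Aᴴ A)_{k k})`. [folklore] -/
theorem norm_toLp_col {ι : Type} [Fintype ι] (A : Matrix ι ι ℂ) (k : ι) :
    ‖(WithLp.toLp 2 fun w => A w k : EuclideanSpace ℂ ι)‖ = Real.sqrt (((Aᴴ * A) k k).re) := by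
  rw [← inner_toLp_col_toLp_col, ← RCLike.re_to_complex, inner_self_eq_norm_sq (𝕜 := ℂ),
    Real.sqrt_sq (norm_nonneg _)]

/-- **Gram–Hadamard bound for PSD-sliced pairings** (body of `PSDGramHadamard`): for `Φ ⪰ 0` and any `D` on a
finite index set, `‖det[(Φ Dᴴ)(xᵢ, yⱼ)]ᵢⱼ‖ ≤ ∏ᵢ √(Re Φ(xᵢ,xᵢ)) · ∏ⱼ √(Re (D Φ Dᴴ)(yⱼ,yⱼ))`.
[Gram–Hadamard inequality; GK doi:10.1007/bf01208817 §3, FMRS doi:10.1007/bf01464282 (Gram bounds for fermions)] -/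
theorem stub_psdGramHadamardDet :
    ∀ (ι : Type) [Fintype ι] [DecidableEq ι] (Φ D : Matrix ι ι ℂ), Φ.PosSemidef →
      ∀ (n : ℕ) (x y : Fin n → ι),
        ‖(Matrix.of fun i j => (Φ * Dᴴ) (x i) (y j)).det‖ ≤
          (∏ i, Real.sqrt ((Φ (x i) (x i)).re)) * ∏ j, Real.sqrt (((D * Φ * Dᴴ) (y j) (y j)).re) := by
  intro ι _ _ Φ D hΦ n x y
  -- Gram factorisation `Φ = Rᴴ R` of the positive semidefinite slice
  obtain ⟨R, rfl⟩ :=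
    Literature.LinearAlgebra.Matrix.exists_eq_conjTranspose_mul_self_of_posSemidef hΦ
  -- the columns `x i` of `R` and `y j` of `R Dᴴ`, as vectors of `ℓ²(ι)`
  let f : Fin n → EuclideanSpace ℂ ι := fun i => WithLp.toLp 2 fun w => R w (x i)
  let g : Fin n → EuclideanSpace ℂ ι := fun j => WithLp.toLp 2 fun w => (R * Dᴴ) w (y j)
  have hM : (Matrix.of fun i j => (Rᴴ * R * Dᴴ) (x i) (y j)) =
      Matrix.of fun i j => ⟪f i, g j⟫_ℂ := by
    ext i j
    simp only [Matrix.of_apply, f, g]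
    rw [inner_toLp_col_toLp_col, Matrix.mul_assoc]
  have hf : ∀ i, ‖f i‖ = Real.sqrt (((Rᴴ * R) (x i) (x i)).re) := fun i => norm_toLp_col R (x i)
  have hRD : (R * Dᴴ)ᴴ * (R * Dᴴ) = D * (Rᴴ * R) * Dᴴ := by
    rw [Matrix.conjTranspose_mul, Matrix.conjTranspose_conjTranspose]
    simp only [Matrix.mul_assoc]
  have hg : ∀ j, ‖g j‖ = Real.sqrt (((D * (Rᴴ * R) * Dᴴ) (y j) (y j)).re) := fun j => by
    rw [← hRD]
    exact norm_toLp_col (R * Dᴴ) (y j)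
  rw [hM]
  calc ‖(Matrix.of fun i j => ⟪f i, g j⟫_ℂ).det‖ ≤ (∏ i, ‖f i‖) * ∏ j, ‖g j‖ :=
        Literature.Analysis.InnerProduct.norm_det_inner_le_prod_norm_mul_prod_norm f g
    _ = (∏ i, Real.sqrt (((Rᴴ * R) (x i) (x i)).re)) *
          ∏ j, Real.sqrt (((D * (Rᴴ * R) * Dᴴ) (y j) (y j)).re) := by
        simp only [hf, hg]

end Summit.QuantumFields.QCD.Cruxes.InterleavedFlowProper.FiniteRangeHeatSlices
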